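import Summits.AtomisticToContinuum.HydrodynamicLimit.Theorems.CollisionIsometryCLTCollisionalTransferLocalityDefs
import HarnessLib

/-!
# Slaving reduction (stub `stub_slavingReduction`) of the line `hemisphere-affine-slaving`,
crux `CollisionalTransferLocality` (stmt-AtomisticToContinuum-9518)

The pure bookkeeping step of the line: at a fixed reduced density `σ`, profiles `(a₀, θ₀, u₀)` and
flow family `Φ`, the balance identity [S1] (`BalanceFor σ Φ`: `Cc = J_N` on the good set), the
lever (`AffineSlavingIdentity`: `chaosAvg = affW`, hence `Sraw_N = S_N` pathwise for a nonnegative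
kernel and space-smooth slices, `Sraw_eq_Sfun`), and the three convergences in local-Gibbs
probability [A'] (`FluxMomentChaos`: `J_N − Sraw_N → 0`), [B] (`ThermoVirial`:
`S_N − (Rhs_N + K_N) → 0`), [C] (`RelaxC`: `K_N → 0`) — each uniformly in `τ ≤ t`, for all `t > 0`,
admissible kernels and smooth tests — imply the crux's conclusion at `(σ, profiles, Φ)`
(`ConclusionAtFlow`, definitionally the crux's `let`-telescope, `conclusionAtFlow_iff`).

Proof: on the good set and for `τ ∈ [0, t]`,
`Cc − Rhs = (J − Sraw) + (S − (Rhs + K)) + K`, so the bad event `{∃ τ ≤ t, δ < |Cc − Rhs|}` is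
covered by the complement of the good set (null for the local Gibbs law, which is absolutely
continuous with respect to the Liouville measure) and the three bad events at level `δ/3`; a union
bound (outer measure, no measurability needed) and a squeeze in `ℝ≥0∞` conclude.

No new definitions; no named facts; sorry-free. Sources: the line's vocabulary file
`CollisionIsometryCLTCollisionalTransferLocalityDefs` (lead prover of the line); the null-set remark
is `HardSphereFlow.measure_compl_good` transported through `Measure.withDensity`.
-/

namespace Summit.AtomisticToContinuum.HydrodynamicLimit.Theorems.HemisphereAffineSlaving

open scoped BigOperators Topology Manifold Classical MeasureTheory ProbabilityTheory Matrix InnerProductSpace ComplexConjugate ContinuousMap ENNReal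
open Filter Set Function TopologicalSpace MeasureTheory

noncomputable section

open Literature.MathematicalPhysics.KineticTheory (T3 V3)

/-- The elementary real-number step of the union bound: if `c − r = (j − w) + (f − (r + k)) + k`
(here: `c = j` and `w = f`) and each of the three summands is at most `δ/3` in absolute value, then
`|c − r| ≤ δ`. [folklore] -/
theorem abs_sub_le_of_three_parts {c r j w f k δ : ℝ} (hcj : c = j) (hwf : w = f)
    (h1 : |j - w| ≤ δ / 3) (h2 : |f - (r + k)| ≤ δ / 3) (h3 : |k| ≤ δ / 3) : |c - r| ≤ δ := by
  have key : c - r = (j - w) + (f - (r + k)) + k := by rw [hcj, hwf]; ring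
  rw [key]
  calc |(j - w) + (f - (r + k)) + k| ≤ |j - w| + |f - (r + k)| + |k| := abs_add_three _ _ _
    _ ≤ δ / 3 + δ / 3 + δ / 3 := add_le_add (add_le_add h1 h2) h3
    _ = δ := by ring

/-- The union-bound step in `ℝ≥0∞`: a set covered by a null set and three further sets has measure
at most the sum of the three measures (outer measure: no measurability is needed). [folklore] -/
theorem measure_le_add_three_of_subset {Ω : Type*} [MeasurableSpace Ω] (μ : Measure Ω)
    {S G A B C : Set Ω} (hG : μ G = 0) (hS : S ⊆ G ∪ (A ∪ (B ∪ C))) :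
    μ S ≤ μ A + (μ B + μ C) := by
  calc μ S ≤ μ (G ∪ (A ∪ (B ∪ C))) := measure_mono hS
    _ ≤ μ G + μ (A ∪ (B ∪ C)) := measure_union_le _ _
    _ ≤ μ G + (μ A + μ (B ∪ C)) := add_le_add le_rfl (measure_union_le _ _)
    _ ≤ μ G + (μ A + (μ B + μ C)) := add_le_add le_rfl (add_le_add le_rfl (measure_union_le _ _))
    _ = μ A + (μ B + μ C) := by rw [hG, zero_add]

/-- **Registered stub `stub_slavingReduction`** of crux stmt-AtomisticToContinuum-9518 (line
hemisphere-affine-slaving): the SLAVING REDUCTION. For `0 < σ ≤ 1/2`, nice profiles and a flow family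
`Φ`: [S1] `BalanceFor σ Φ` ∧ the lever `AffineSlavingIdentity` ∧ [A'] `FluxMomentChaos` ∧
[B] `ThermoVirial` ∧ [C] `RelaxC` (the last three for all `t > 0`, admissible kernels and smooth
space–time tests) ⟹ `ConclusionAtFlow σ a₀ θ₀ u₀ Φ` (verbatim the crux's conclusion at `(σ, profiles,
Φ)`). On the good set `Cc = J` ([S1]) and, the kernel being nonnegative and the slices `ψ s`,
`s ∈ (0, τ] ⊆ [0, t]`, smooth (`IsSmoothSpaceTimeOn.isSmooth_slice`), `Sraw = S` pathwise
(`Sraw_eq_Sfun`); hence `|Cc − Rhs| ≤ |J − Sraw| + |S − (Rhs + K)| + |K|`, the bad event at level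
`δ` is covered by the three bad events at level `δ/3` and the null complement of the good set
(`localGibbsLaw ≪ liouville`), and the three probabilities tend to `0`. The hypotheses `0 < σ`,
`σ ≤ 1/2`, `NiceProfiles` are not used by this step (they are part of the registered signature for
the composition). [folklore] -/
theorem stub_slavingReduction :
    ∀ σ : ℝ, 0 < σ → σ ≤ 1 / 2 → ∀ (a₀ θ₀ : T3 → ℝ) (u₀ : T3 → V3), NiceProfiles a₀ θ₀ u₀ →
      ∀ Φ : Flows σ, BalanceFor σ Φ → AffineSlavingIdentity →
        (∀ t : ℝ, 0 < t →
          ∀ (γ C : ℝ) (φ : ℕ → T3 → ℝ), 0 < γ → γ ≤ 1 / 15 → AdmissibleKernel γ C φ →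
            ∀ (ψ : ℝ → T3 → V3) (χ : ℝ → T3 → ℝ),
              Literature.Analysis.FunctionSpaces.Torus.IsSmoothSpaceTimeOn (Icc 0 t) ψ →
              Literature.Analysis.FunctionSpaces.Torus.IsSmoothSpaceTimeOn (Icc 0 t) χ →
              FluxMomentChaos σ a₀ θ₀ u₀ Φ φ t ψ χ) →
        (∀ t : ℝ, 0 < t →
          ∀ (γ C : ℝ) (φ : ℕ → T3 → ℝ), 0 < γ → γ ≤ 1 / 15 → AdmissibleKernel γ C φ →
            ∀ (ψ : ℝ → T3 → V3) (χ : ℝ → T3 → ℝ),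
              Literature.Analysis.FunctionSpaces.Torus.IsSmoothSpaceTimeOn (Icc 0 t) ψ →
              Literature.Analysis.FunctionSpaces.Torus.IsSmoothSpaceTimeOn (Icc 0 t) χ →
              ThermoVirial σ a₀ θ₀ u₀ Φ φ t ψ χ) →
        (∀ t : ℝ, 0 < t →
          ∀ (γ C : ℝ) (φ : ℕ → T3 → ℝ), 0 < γ → γ ≤ 1 / 15 → AdmissibleKernel γ C φ →
            ∀ (ψ : ℝ → T3 → V3) (χ : ℝ → T3 → ℝ),
              Literature.Analysis.FunctionSpaces.Torus.IsSmoothSpaceTimeOn (Icc 0 t) ψ →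
              Literature.Analysis.FunctionSpaces.Torus.IsSmoothSpaceTimeOn (Icc 0 t) χ →
              RelaxC σ a₀ θ₀ u₀ Φ φ t ψ χ) →
        ConclusionAtFlow σ a₀ θ₀ u₀ Φ := by
  intro σ _hσ _hσ' a₀ θ₀ u₀ _hP Φ hBal hId hA hB hC
  rw [conclusionAtFlow_iff]
  intro γ C φ hγ hγ' hadm t ht ψ χ hψ hχ δ hδ
  have hδ3 : 0 < δ / 3 := by positivity
  have hA' := hA t ht γ C φ hγ hγ' hadm ψ χ hψ hχ (δ / 3) hδ3
  have hB' := hB t ht γ C φ hγ hγ' hadm ψ χ hψ hχ (δ / 3) hδ3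
  have hC' := hC t ht γ C φ hγ hγ' hadm ψ χ hψ hχ (δ / 3) hδ3
  have hsum := hA'.add (hB'.add hC')
  rw [add_zero, add_zero] at hsum
  refine tendsto_of_tendsto_of_tendsto_of_le_of_le tendsto_const_nhds hsum (fun _ => zero_le)
    fun N => ?_
  -- the complement of the good set is null for the local Gibbs law (`≪ liouville`)
  have hnull : Literature.MathematicalPhysics.KineticTheory.localGibbsLaw σ a₀ u₀ θ₀ N (Φ N)
      (Φ N).goodᶜ = 0 := by
    unfold Literature.MathematicalPhysics.KineticTheory.localGibbsLaw
      Literature.Analysis.FluidPDE.particleLaw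
    exact withDensity_absolutelyContinuous _ _ (Φ N).measure_compl_good
  refine measure_le_add_three_of_subset _ hnull ?_
  rintro z ⟨τ, hτ, hzδ⟩
  by_cases hz : z ∈ (Φ N).good
  · right
    have h1 : Cc σ Φ ψ χ N z τ = Jfun σ Φ ψ χ N z τ := hBal N t ht ψ χ hψ hχ z hz τ hτ
    have h2 : Sraw σ Φ φ ψ χ N z τ = Sfun σ Φ φ ψ χ N z τ :=
      Sraw_eq_Sfun hId σ Φ φ ψ χ N (hadm.2.1 N) z τ
        (fun s hs => hψ.isSmooth_slice ⟨hs.1.le, hs.2.trans hτ.2⟩)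
    by_contra hno
    simp only [Set.mem_union, Set.mem_setOf_eq, not_or, not_exists, not_and, not_lt] at hno
    obtain ⟨hn1, hn2, hn3⟩ := hno
    have hle := abs_sub_le_of_three_parts h1 h2 (hn1 τ hτ) (hn2 τ hτ) (hn3 τ hτ)
    exact absurd hzδ (not_lt.2 hle)
  · exact Or.inl hz

end

end Summit.AtomisticToContinuum.HydrodynamicLimit.Theorems.HemisphereAffineSlaving
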